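import Literature.NumberTheory.NumberFields.BhargavaQuinticSpaceFrames
import Mathlib.LinearAlgebra.Dimension.OrzechProperty
import Mathlib.LinearAlgebra.Finsupp.LinearCombination
import HarnessLib

/-!
# Bhargava's quintic space: quadrics through five points in general position

Support file for the named fact
`Literature.NumberTheory.NumberFields.BhargavaQuinticSpace.WrightYukie1992_orbit_bijective_etaleQuintic`
(file `BhargavaQuinticSpace.lean`), towards part (b), direction ⟸.  Everything here is PROVED.

The classical dimension count behind Bhargava's remark that the five `4 × 4` sub-Pfaffians of a
non-degenerate `A` "cut out" the five points and span the quadrics through them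
[Bhargava2008, §2 p. 62]: quaternary quadratic forms are a `10`-dimensional space (`quadOf`, with
the ten monomials `monoQ`), five points in general position impose INDEPENDENT conditions on it
(`exists_quadOf_separating`: for each point a product of two planes vanishing at the other four but
not at it; `range_evalFive_comp_quadOf`), so the forms vanishing at them have dimension `10 - 5 = 5`
(`finrank_ker_evalFive_comp_quadOf`).  Consequently (`mem_span_subPfaffian_of_vanish`), if the five
quadrics `Qᵢ(A)` are linearly independent and vanish at five points in general position, every
quadratic form vanishing there is a combination of them, and two such `A, A'` have
`Q(A') = M · Q(A)` for a matrix `M` (`exists_matrix_subPfaffian_eq`).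

## References

* M. Bhargava, *Higher composition laws IV*, Ann. of Math. 167 (2008), 53–94, §2 p. 62. [Bhargava2008]
* A. Yukie, *Shintani Zeta Functions*, LMS LNS 183, CUP (1993), §0.4. [Yukie1993]
-/

noncomputable section

open Matrix
open scoped LinearAlgebra.Projectivization

namespace Literature.NumberTheory.NumberFields
namespace BhargavaQuinticSpace

universe u

/-! ### Quaternary quadratic forms as functions -/

section Quadrics

variable {K : Type*} [Field K]

/-- The ten quadratic monomials `t₀², t₀t₁, t₀t₂, t₀t₃, t₁², t₁t₂, t₁t₃, t₂², t₂t₃, t₃²`. [folklore] -/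
def monoQ : Fin 10 → (Fin 4 → K) → K :=
  ![fun t => t 0 * t 0, fun t => t 0 * t 1, fun t => t 0 * t 2, fun t => t 0 * t 3,
    fun t => t 1 * t 1, fun t => t 1 * t 2, fun t => t 1 * t 3,
    fun t => t 2 * t 2, fun t => t 2 * t 3, fun t => t 3 * t 3]

/-- The quadratic form with coefficient vector `c ∈ K¹⁰`, as a function on `K⁴`; a linear map
`K¹⁰ → (K⁴ → K)`. [folklore] -/
def quadOf : (Fin 10 → K) →ₗ[K] ((Fin 4 → K) → K) where
  toFun c := fun t => ∑ m, c m * monoQ m t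
  map_add' c c' := by
    funext t
    simp [add_mul, Finset.sum_add_distrib]
  map_smul' a c := by
    funext t
    simp [Finset.mul_sum, mul_assoc]

/-- Unfolding `quadOf`. [folklore] -/
theorem quadOf_apply (c : Fin 10 → K) (t : Fin 4 → K) : quadOf c t = ∑ m, c m * monoQ m t := rfl

/-- The product of two linear forms is a quadratic form (explicit coefficients). [folklore] -/
theorem mulLin_eq_quadOf (l l' : Fin 4 → K) :
    (fun t : Fin 4 → K => (∑ i, l i * t i) * (∑ j, l' j * t j)) =
      quadOf ![l 0 * l' 0, l 0 * l' 1 + l 1 * l' 0, l 0 * l' 2 + l 2 * l' 0, l 0 * l' 3 + l 3 * l' 0,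
        l 1 * l' 1, l 1 * l' 2 + l 2 * l' 1, l 1 * l' 3 + l 3 * l' 1,
        l 2 * l' 2, l 2 * l' 3 + l 3 * l' 2, l 3 * l' 3] := by
  funext t
  simp [quadOf_apply, monoQ, Fin.sum_univ_succ]
  ring

/-- Products of linear forms lie in the space of quadratic forms. [folklore] -/
theorem mulLin_mem_range_quadOf (l l' : Fin 4 → K) :
    (fun t : Fin 4 → K => (∑ i, l i * t i) * (∑ j, l' j * t j)) ∈ LinearMap.range (quadOf (K := K)) := by
  rw [mulLin_eq_quadOf]
  exact LinearMap.mem_range_self _ _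

/-- The five quadrics `Qᵢ(A)` are quadratic forms. [folklore] -/
theorem subPfaffian_mem_range_quadOf (x : BhargavaQuinticSpace K) (m : Fin 5) :
    (subPfaffian x m : (Fin 4 → K) → K) ∈ LinearMap.range (quadOf (K := K)) := by
  -- entries of the pencil are linear forms
  set L : Fin 5 → Fin 5 → Fin 4 → K := fun a b i => (x i : Matrix (Fin 5) (Fin 5) K) a b with hL
  have hpen : ∀ (t : Fin 4 → K) (a b : Fin 5), pencil x t a b = ∑ i, L a b i * t i := by
    intro t a b
    simp [pencil, Matrix.sum_apply, hL, mul_comm]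
  have hfun : (subPfaffian x m : (Fin 4 → K) → K) =
      ((-1 : K) ^ (m : ℕ)) •
        ((fun t => (∑ i, L (m.succAbove 0) (m.succAbove 1) i * t i) *
            (∑ i, L (m.succAbove 2) (m.succAbove 3) i * t i)) -
          (fun t => (∑ i, L (m.succAbove 0) (m.succAbove 2) i * t i) *
            (∑ i, L (m.succAbove 1) (m.succAbove 3) i * t i)) +
          (fun t => (∑ i, L (m.succAbove 0) (m.succAbove 3) i * t i) *
            (∑ i, L (m.succAbove 1) (m.succAbove 2) i * t i))) := by
    funext t
    simp only [subPfaffian, subPfVec, pf4, Matrix.submatrix_apply, hpen, Pi.smul_apply, Pi.add_apply,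
      Pi.sub_apply, smul_eq_mul]
  rw [hfun]
  refine Submodule.smul_mem _ _ (Submodule.add_mem _ (Submodule.sub_mem _ ?_ ?_) ?_) <;>
    exact mulLin_mem_range_quadOf _ _

/-- Evaluation of functions at five points, a linear map. [folklore] -/
def evalFive (v : Fin 5 → (Fin 4 → K)) : ((Fin 4 → K) → K) →ₗ[K] (Fin 5 → K) where
  toFun q := fun i => q (v i)
  map_add' _ _ := rfl
  map_smul' _ _ := rfl

/-- Unfolding `evalFive`. [folklore] -/
theorem evalFive_apply (v : Fin 5 → (Fin 4 → K)) (q : (Fin 4 → K) → K) (i : Fin 5) :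
    evalFive v q i = q (v i) := rfl

/-! ### Quadrics through five points in general position -/

variable {p : Fin 5 → ℙ K (Fin 4 → K)} (F : FrameData p)

/-- The coordinate functional `t ↦ (t)ⱼ` in the frame basis, written as a linear form. [folklore] -/
theorem coord_eq_sum (j : Fin 4) (t : Fin 4 → K) :
    F.b.coord j t = ∑ i, F.b.coord j (Pi.single i 1) * t i := by
  rw [LinearMap.pi_apply_eq_sum_univ (F.b.coord j) t]
  refine Finset.sum_congr rfl fun i _ => ?_
  rw [smul_eq_mul, mul_comm]
  congr 2
  funext j'
  simp [Pi.single_apply, eq_comm]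

/-- Coordinates of the basis vectors of the frame. [folklore] -/
theorem coord_v_castSucc (j m : Fin 4) : F.b.coord j (F.v (Fin.castSucc m)) = if m = j then 1 else 0 := by
  rw [← F.b_eq, Module.Basis.coord_apply, Module.Basis.repr_self, Finsupp.single_apply]

/-- Coordinates of the fifth frame vector: `(v₄)ⱼ = aⱼ`. [folklore] -/
theorem coord_v_last (j : Fin 4) : F.b.coord j (F.v (Fin.last 4)) = F.a j := by
  rw [F.v_last, Module.Basis.coord_apply]
  have : ∑ j', F.a j' • F.v (Fin.castSucc j') = ∑ j', F.a j' • F.b j' :=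
    Finset.sum_congr rfl fun j' _ => by rw [F.b_eq]
  rw [this, F.b.repr_sum_self]

/-- **Separating quadrics.** For each of the five points there is a quadratic form vanishing at the
other four but not at it (a product of two planes). [folklore] -/
theorem exists_quadOf_separating (i : Fin 5) :
    ∃ (c : Fin 10 → K) (d : K), d ≠ 0 ∧ evalFive F.v (quadOf c) = d • Pi.single i 1 := by
  classical
  induction i using Fin.lastCases with
  | last =>
    -- `l₀ · l₁`
    obtain ⟨c, hc⟩ : ∃ c : Fin 10 → K, quadOf c = fun t => F.b.coord 0 t * F.b.coord 1 t := by
      obtain ⟨c, hc⟩ := mulLin_mem_range_quadOf (K := K) (fun i => F.b.coord 0 (Pi.single i 1))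
        (fun i => F.b.coord 1 (Pi.single i 1))
      refine ⟨c, ?_⟩
      rw [hc]
      funext t
      rw [coord_eq_sum F 0 t, coord_eq_sum F 1 t]
    refine ⟨c, F.a 0 * F.a 1, mul_ne_zero (F.a_ne 0) (F.a_ne 1), ?_⟩
    funext m
    rw [evalFive_apply, hc]
    dsimp only
    induction m using Fin.lastCases with
    | last =>
      rw [coord_v_last, coord_v_last]
      simp
    | cast m =>
      rw [coord_v_castSucc, coord_v_castSucc]
      have h : (Fin.castSucc m : Fin 5) ≠ Fin.last 4 := (Fin.castSucc_lt_last m).ne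
      simp only [Pi.smul_apply, Pi.single_apply, h, if_false, smul_zero]
      by_cases h0 : m = 0
      · subst h0
        simp
      · simp [h0]
  | cast j =>
    -- `l_j · (a_j l_{j'} - a_{j'} l_j)` with `j' ≠ j`
    obtain ⟨j', hj'⟩ : ∃ j' : Fin 4, j' ≠ j := ⟨j + 1, by simp⟩
    obtain ⟨c, hc⟩ : ∃ c : Fin 10 → K, quadOf c =
        fun t => F.b.coord j t * (F.a j * F.b.coord j' t - F.a j' * F.b.coord j t) := by
      obtain ⟨c, hc⟩ := mulLin_mem_range_quadOf (K := K) (fun i => F.b.coord j (Pi.single i 1))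
        (fun i => F.a j * F.b.coord j' (Pi.single i 1) - F.a j' * F.b.coord j (Pi.single i 1))
      refine ⟨c, ?_⟩
      rw [hc]
      funext t
      have h2 : (∑ i, (F.a j * F.b.coord j' (Pi.single i 1) - F.a j' * F.b.coord j (Pi.single i 1)) * t i) =
          F.a j * F.b.coord j' t - F.a j' * F.b.coord j t := by
        rw [coord_eq_sum F j t, coord_eq_sum F j' t, Finset.mul_sum, Finset.mul_sum,
          ← Finset.sum_sub_distrib]
        refine Finset.sum_congr rfl fun i _ => ?_
        ring
      rw [h2, ← coord_eq_sum F j t]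
    refine ⟨c, -F.a j', neg_ne_zero.mpr (F.a_ne j'), ?_⟩
    funext m
    rw [evalFive_apply, hc]
    dsimp only
    induction m using Fin.lastCases with
    | last =>
      simp only [coord_v_last]
      have h : (Fin.last 4 : Fin 5) ≠ Fin.castSucc j := (Fin.castSucc_lt_last j).ne'
      simp only [Pi.smul_apply, Pi.single_apply, h, if_false, smul_zero]
      ring
    | cast m =>
      simp only [coord_v_castSucc]
      simp only [Pi.smul_apply, Pi.single_apply, smul_eq_mul, Fin.castSucc_inj]
      by_cases hm : m = j
      · subst hm
        have : ¬ (m = j') := fun h => hj' h.symm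
        simp [this]
      · simp [hm]

/-- Evaluation at the five points is surjective on quadratic forms: they impose independent
conditions on quadrics. [folklore] -/
theorem range_evalFive_comp_quadOf : LinearMap.range (evalFive F.v ∘ₗ quadOf) = ⊤ := by
  classical
  rw [eq_top_iff]
  intro w _
  have hw : w = ∑ i, w i • Pi.single i (1 : K) := by
    ext j
    simp [Finset.sum_apply, Pi.single_apply]
  rw [hw]
  refine Submodule.sum_mem _ fun i _ => Submodule.smul_mem _ _ ?_
  obtain ⟨c, d, hd, hcd⟩ := exists_quadOf_separating F i
  refine ⟨d⁻¹ • c, ?_⟩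
  rw [LinearMap.map_smul, LinearMap.comp_apply, hcd, smul_smul, inv_mul_cancel₀ hd, one_smul]

/-- The quadratic forms vanishing at five points in general position form a space of dimension
`10 - 5 = 5` (in coefficient space). [folklore] -/
theorem finrank_ker_evalFive_comp_quadOf :
    Module.finrank K (LinearMap.ker (evalFive F.v ∘ₗ quadOf)) = 5 := by
  have h := LinearMap.finrank_range_add_finrank_ker (evalFive F.v ∘ₗ (quadOf (K := K)))
  rw [range_evalFive_comp_quadOf F, finrank_top, Module.finrank_fintype_fun_eq_card,
    Module.finrank_fintype_fun_eq_card] at h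
  simp only [Fintype.card_fin] at h
  omega

/-- **Quadrics through five general points.** If the five quadrics of `A` are linearly independent
and vanish at five points in general position, then EVERY quadratic form vanishing at these points
is a linear combination of them (dimension count `10 - 5 = 5`). [cite: Bhargava2008, §2 p. 62] -/
theorem mem_span_subPfaffian_of_vanish (x : BhargavaQuinticSpace K)
    (hli : LinearIndependent K (fun i : Fin 5 => (subPfaffian x i : (Fin 4 → K) → K)))
    (hx : ∀ i m, subPfaffian x i (F.v m) = 0)
    {q : (Fin 4 → K) → K} (hq : q ∈ LinearMap.range (quadOf (K := K))) (hqv : ∀ m, q (F.v m) = 0) :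
    q ∈ Submodule.span K (Set.range fun i : Fin 5 => (subPfaffian x i : (Fin 4 → K) → K)) := by
  classical
  by_contra hqmem
  -- coefficient vectors
  have hcx : ∀ i, ∃ c : Fin 10 → K, quadOf c = subPfaffian x i := fun i =>
    subPfaffian_mem_range_quadOf x i
  choose cx hcx using hcx
  obtain ⟨cq, hcq⟩ := hq
  -- all lie in the kernel of evaluation
  set Ψ := evalFive F.v ∘ₗ (quadOf (K := K)) with hΨ
  have hker : ∀ c : Fin 10 → K, (∀ m, quadOf c (F.v m) = 0) → c ∈ LinearMap.ker Ψ := by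
    intro c hc
    rw [LinearMap.mem_ker]
    funext m
    exact hc m
  -- the six vectors `cq, cx 0, …, cx 4` are linearly independent
  have hli6 : LinearIndependent K (Fin.cons cq cx : Fin 6 → Fin 10 → K) := by
    refine LinearIndependent.finCons ?_ ?_
    · apply LinearIndependent.of_comp (quadOf (K := K))
      have : ⇑(quadOf (K := K)) ∘ cx = fun i => (subPfaffian x i : (Fin 4 → K) → K) := funext hcx
      rw [this]
      exact hli
    · intro hmem
      apply hqmem
      have himg := Submodule.mem_map_of_mem (f := quadOf (K := K)) hmem
      rw [Submodule.map_span, hcq] at himg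
      have hset : ⇑(quadOf (K := K)) '' Set.range cx =
          Set.range fun i : Fin 5 => (subPfaffian x i : (Fin 4 → K) → K) := by
        rw [← Set.range_comp]
        exact congrArg Set.range (funext hcx)
      rwa [hset] at himg
  -- but they lie in a `5`-dimensional space
  have hle : Submodule.span K (Set.range (Fin.cons cq cx : Fin 6 → Fin 10 → K)) ≤ LinearMap.ker Ψ := by
    rw [Submodule.span_le]
    rintro _ ⟨i, rfl⟩
    induction i using Fin.cases with
    | zero =>
      simp only [Fin.cons_zero]
      exact hker cq fun m => by rw [hcq]; exact hqv m
    | succ i =>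
      simp only [Fin.cons_succ]
      exact hker (cx i) fun m => by rw [hcx]; exact hx i m
  have h1 : Module.finrank K (Submodule.span K (Set.range (Fin.cons cq cx : Fin 6 → Fin 10 → K))) = 6 := by
    rw [finrank_span_eq_card hli6, Fintype.card_fin]
  have h2 := Submodule.finrank_mono hle
  rw [finrank_ker_evalFive_comp_quadOf F, h1] at h2
  omega

/-- The change-of-basis matrix: if `A` and `A'` both have linearly independent quadrics vanishing
at the same five points in general position, then `Q(A') = M Q(A)` for a (unique) matrix `M`.
[cite: Bhargava2008, §2 p. 62] -/
theorem exists_matrix_subPfaffian_eq (x y : BhargavaQuinticSpace K)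
    (hli : LinearIndependent K (fun i : Fin 5 => (subPfaffian x i : (Fin 4 → K) → K)))
    (hx : ∀ i m, subPfaffian x i (F.v m) = 0) (hy : ∀ i m, subPfaffian y i (F.v m) = 0) :
    ∃ M : Matrix (Fin 5) (Fin 5) K, ∀ i t, subPfaffian y i t = ∑ j, M i j * subPfaffian x j t := by
  have hmem : ∀ i, (subPfaffian y i : (Fin 4 → K) → K) ∈
      Submodule.span K (Set.range fun j : Fin 5 => (subPfaffian x j : (Fin 4 → K) → K)) := fun i =>
    mem_span_subPfaffian_of_vanish F x hli hx (subPfaffian_mem_range_quadOf y i) (hy i)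
  choose M hM using fun i => (Submodule.mem_span_range_iff_exists_fun (R := K)).mp (hmem i)
  refine ⟨Matrix.of M, fun i t => ?_⟩
  have := congrFun (hM i) t
  simp only [Finset.sum_apply, Pi.smul_apply, smul_eq_mul] at this
  rw [← this]
  rfl

end Quadrics

end BhargavaQuinticSpace
end Literature.NumberTheory.NumberFields
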